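import Literature.Geometry.Lorentzian.DecaySymbols
import Mathlib.Analysis.SpecialFunctions.Sqrt
import HarnessLib

/-!
# Smooth symbols at infinity: the square root of an elliptic symbol of arbitrary order

Support file (all results proved, no definitions, no named facts), an addition to the symbol
calculus `IsBigOSmooth` of `DecaySymbols.lean` and a companion of `DecaySymbolsInverse.lean`
(`DecaySymbolsSqrt.lean` has the order-zero case `√f` for `f → 1`; here the order is arbitrary): if
`g : E → ℝ` is a smooth symbol of order `b` to second order which is elliptic at that order,
`g(y) ≥ c‖y‖^b` far out (`c > 0`), then `√g` is a smooth symbol of order `b/2` to second order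
(`IsBigOSmooth.sqrt_of_elliptic`): `√g ≤ C r^{b/2}` from `|g| ≤ C r^b`,
`D√g = Dg/(2√g)` has norm `≲ r^{b−1} r^{−b/2}`, and `D²√g = D²g/(2√g) − Dg ⊗ Dg/(4 g^{3/2})` has
norm `≲ r^{b/2−2}`. Used for the inverse lapse `α⁻¹ = √(A/(ΔΣ))` of the Boyer–Lindquist slicing of
Kerr, `A/(ΔΣ) = O₂(1)` elliptic.

References: R. Bartnik, CPAM 39 (1986), Prop. 2.2 (functional calculus in weighted classes);
R. Schoen, S.-T. Yau, Comm. Math. Phys. 65 (1979), §1, (1.1).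
-/

noncomputable section

open Filter Asymptotics Bornology Set
open scoped Topology ContDiff

namespace Literature.Geometry.Lorentzian

namespace IsBigOSmooth

variable {E : Type*} [NormedAddCommGroup E] [InnerProductSpace ℝ E] {b : ℝ} {g : E → ℝ}

/-- **The square root of an elliptic symbol.** If `g = O₂(r^b)` is a smooth symbol with
`g(y) ≥ c ‖y‖^b` far out (`c > 0`), then `√g = O₂(r^{b/2})`: `D√g = (2√g)⁻¹ Dg`,
`D²√g = (2√g)⁻¹ D²g − ¼ g^{−3/2} Dg ⊗ Dg`. Bartnik 1986, Prop. 2.2. [cite: Bartnik1986, Prop. 2.2] -/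
theorem sqrt_of_elliptic (hg : IsBigOSmooth 2 b g) {c : ℝ} (hc : 0 < c)
    (hlow : ∀ᶠ y in cobounded E, c * ‖y‖ ^ b ≤ g y) :
    IsBigOSmooth 2 (b / 2) fun y ↦ √(g y) := by
  obtain ⟨⟨R₀, hR₀⟩, hO⟩ := hg
  -- a far radius beyond which `g` is smooth, `≥ c r^b > 0`, and `r ≥ 1`
  obtain ⟨R₁, -, hR₁⟩ := hasBasis_cobounded_norm.eventually_iff.1
    (hlow.and (eventually_cobounded_le_norm (E := E) 1))
  set R : ℝ := max R₀ R₁ with hRdef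
  have hfar : ∀ y : E, R < ‖y‖ → R₀ < ‖y‖ ∧ c * ‖y‖ ^ b ≤ g y ∧ 1 ≤ ‖y‖ := fun y hy ↦
    ⟨(le_max_left _ _).trans_lt hy,
      (hR₁ (show y ∈ {x : E | R₁ ≤ ‖x‖} from ((le_max_right _ _).trans hy.le))).1,
      (hR₁ (show y ∈ {x : E | R₁ ≤ ‖x‖} from ((le_max_right _ _).trans hy.le))).2⟩
  have hpos : ∀ y : E, R < ‖y‖ → 0 < g y := fun y hy ↦ by
    obtain ⟨-, h2, h3⟩ := hfar y hy
    exact (mul_pos hc (Real.rpow_pos_of_pos (by linarith) b)).trans_le h2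
  -- `√c r^{b/2} ≤ √g` far out
  have hsqhalf : ∀ y : E, √(‖y‖ ^ b) = ‖y‖ ^ (b / 2) := fun y ↦ by
    rw [Real.sqrt_eq_rpow, ← Real.rpow_mul (norm_nonneg y)]
    congr 1
    ring
  have hsq : ∀ y : E, R < ‖y‖ → √c * ‖y‖ ^ (b / 2) ≤ √(g y) := fun y hy ↦ by
    obtain ⟨-, h2, -⟩ := hfar y hy
    rw [← hsqhalf, ← Real.sqrt_mul hc.le]
    exact Real.sqrt_le_sqrt h2
  set U : Set E := {y | R < ‖y‖} with hU
  have hUo : IsOpen U := isOpen_setOf_lt_norm R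
  have hgU : ContDiffOn ℝ ∞ g U := hR₀.mono (setOf_lt_norm_anti (le_max_left _ _))
  have hgC : ∀ y ∈ U, ContDiffAt ℝ ∞ g y := fun y hy ↦ hgU.contDiffAt (hUo.mem_nhds hy)
  -- smoothness of `√g` far out
  have hsqrtU : ContDiffOn ℝ ∞ (fun y ↦ √(g y)) U := fun y hy ↦
    ((hgC y hy).sqrt (hpos y hy).ne').contDiffWithinAt
  -- the first derivative far out: `D√g = (2√g)⁻¹ • Dg`
  have hD1 : ∀ y ∈ U, HasFDerivAt (fun y ↦ √(g y)) ((2 * √(g y))⁻¹ • fderiv ℝ g y) y := by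
    intro y hy
    have h := (Real.hasDerivAt_sqrt (hpos y hy).ne').comp_hasFDerivAt y
      (((hgC y hy).differentiableAt (by simp)).hasFDerivAt)
    rw [one_div] at h
    exact h
  have hD1eq : ∀ y ∈ U, fderiv ℝ (fun y ↦ √(g y)) y = (2 * √(g y))⁻¹ • fderiv ℝ g y := fun y hy ↦
    (hD1 y hy).fderiv
  -- the pieces as `O(·)` statements
  have hφ : (fun y ↦ (2 * √(g y))⁻¹) =O[cobounded E] fun y ↦ ‖y‖ ^ (-(b / 2)) := by
    refine IsBigO.of_bound (2 * √c)⁻¹ ?_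
    filter_upwards [eventually_cobounded_lt_norm (E := E) R] with y hy
    obtain ⟨-, -, h3⟩ := hfar y hy
    have hyb : 0 < ‖y‖ ^ (b / 2) := Real.rpow_pos_of_pos (by linarith) _
    have hgy := hpos y hy
    have hsy := hsq y hy
    have hsc : 0 < √c := Real.sqrt_pos.2 hc
    rw [Real.norm_of_nonneg (by positivity), Real.norm_of_nonneg (by positivity),
      Real.rpow_neg (by linarith), ← mul_inv]
    exact inv_anti₀ (by positivity) (by nlinarith)
  have hψ : (fun y ↦ (√(g y))⁻¹ ^ 3) =O[cobounded E] fun y ↦ ‖y‖ ^ (-(3 * (b / 2))) := by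
    refine IsBigO.of_bound ((√c)⁻¹ ^ 3) ?_
    filter_upwards [eventually_cobounded_lt_norm (E := E) R] with y hy
    obtain ⟨-, -, h3⟩ := hfar y hy
    have hyb : 0 < ‖y‖ ^ (b / 2) := Real.rpow_pos_of_pos (by linarith) _
    have hgy := hpos y hy
    have hsy := hsq y hy
    have hsc : 0 < √c := Real.sqrt_pos.2 hc
    have hsg : 0 < √(g y) := Real.sqrt_pos.2 hgy
    have hpow : ‖y‖ ^ (-(3 * (b / 2))) = ((‖y‖ ^ (b / 2))⁻¹) ^ 3 := by
      rw [Real.rpow_neg (by linarith), mul_comm, Real.rpow_mul (norm_nonneg y),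
        show (3 : ℝ) = ((3 : ℕ) : ℝ) by norm_num, Real.rpow_natCast, ← inv_pow]
    rw [Real.norm_of_nonneg (by positivity), Real.norm_of_nonneg (by positivity), hpow, ← mul_pow,
      ← mul_inv]
    exact pow_le_pow_left₀ (by positivity) (inv_anti₀ (by positivity) hsy) 3
  have hDg : (fun y ↦ ‖fderiv ℝ g y‖) =O[cobounded E] fun y ↦ ‖y‖ ^ (b - 1) := by
    have h := hO 1 (by norm_num)
    simpa only [norm_iteratedFDeriv_one, Nat.cast_one] using h
  have hD2g : (fun y ↦ ‖fderiv ℝ (fderiv ℝ g) y‖) =O[cobounded E] fun y ↦ ‖y‖ ^ (b - 2) := by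
    have h := hO 2 le_rfl
    refine (h.congr_left fun y ↦ ?_).congr_right fun y ↦ by norm_num
    rw [← norm_iteratedFDeriv_fderiv, norm_iteratedFDeriv_one]
  have hg0 : (fun y ↦ g y) =O[cobounded E] fun y ↦ ‖y‖ ^ b := by
    have h := hO 0 (by norm_num)
    simpa only [norm_iteratedFDeriv_zero, Nat.cast_zero, sub_zero, isBigO_norm_left] using h
  refine ⟨⟨R, hsqrtU⟩, fun m hm ↦ ?_⟩
  interval_cases m
  · -- `m = 0`: `√g ≤ √(C r^b) = √C r^{b/2}`
    obtain ⟨C, hC0, hC⟩ := hg0.exists_nonneg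
    refine IsBigO.of_bound (√C) ?_
    filter_upwards [hC.bound, eventually_cobounded_lt_norm (E := E) R] with y hy hyR
    have hgy := hpos y hyR
    have hrb : 0 ≤ ‖y‖ ^ b := Real.rpow_nonneg (norm_nonneg y) b
    rw [Real.norm_of_nonneg hgy.le, Real.norm_of_nonneg hrb] at hy
    rw [norm_iteratedFDeriv_zero, Real.norm_of_nonneg (Real.sqrt_nonneg _),
      Real.norm_of_nonneg (Real.sqrt_nonneg _), Nat.cast_zero, sub_zero,
      Real.norm_of_nonneg (Real.rpow_nonneg (norm_nonneg y) _), ← hsqhalf, ← Real.sqrt_mul hC0]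
    exact Real.sqrt_le_sqrt hy
  · -- `m = 1`: `‖D√g‖ = (2√g)⁻¹ ‖Dg‖`
    have heq : (fun y ↦ ‖iteratedFDeriv ℝ 1 (fun y ↦ √(g y)) y‖) =ᶠ[cobounded E]
        fun y ↦ (2 * √(g y))⁻¹ * ‖fderiv ℝ g y‖ := by
      filter_upwards [eventually_cobounded_lt_norm (E := E) R] with y hy
      have hsg : 0 < √(g y) := Real.sqrt_pos.2 (hpos y hy)
      rw [norm_iteratedFDeriv_one, hD1eq y hy, norm_smul, norm_inv, Real.norm_of_nonneg (by positivity)]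
    have hexp : (fun y : E ↦ ‖y‖ ^ (-(b / 2)) * ‖y‖ ^ (b - 1)) =ᶠ[cobounded E]
        fun y ↦ ‖y‖ ^ (b / 2 - ((1 : ℕ) : ℝ)) := by
      rw [Nat.cast_one, show b / 2 - 1 = -(b / 2) + (b - 1) by ring]
      exact norm_rpow_mul_rpow_eventuallyEq (E := E) _ _
    exact (heq.trans_isBigO (hφ.mul hDg)).trans hexp.isBigO
  · -- `m = 2`: `D((2√g)⁻¹ • Dg) = (2√g)⁻¹ • D²g + (−¼ (√g)⁻³ Dg) ⊗ Dg`
    have hφd : ∀ y ∈ U,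
        HasFDerivAt (fun y ↦ (2 * √(g y))⁻¹) ((-(4⁻¹ * (√(g y))⁻¹ ^ 3)) • fderiv ℝ g y) y := by
      intro y hy
      have hgy := hpos y hy
      have hsg : 0 < √(g y) := Real.sqrt_pos.2 hgy
      have h1 : HasDerivAt (fun t : ℝ ↦ (2 * √t)⁻¹) (-(2 * (1 / (2 * √(g y)))) / (2 * √(g y)) ^ 2)
          (g y) := ((Real.hasDerivAt_sqrt hgy.ne').const_mul 2).inv (by positivity)
      have h2 := h1.comp_hasFDerivAt y (((hgC y hy).differentiableAt (by simp)).hasFDerivAt)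
      refine h2.congr_fderiv ?_
      congr 1
      field_simp
      ring
    have htwo : (2 : WithTop ℕ∞) ≤ ∞ := WithTop.coe_le_coe.2 le_top
    have hF : ∀ y ∈ U, fderiv ℝ (fderiv ℝ fun y ↦ √(g y)) y =
        (2 * √(g y))⁻¹ • fderiv ℝ (fderiv ℝ g) y +
          ((-(4⁻¹ * (√(g y))⁻¹ ^ 3)) • fderiv ℝ g y).smulRight (fderiv ℝ g y) := by
      intro y hy
      have hev : (fderiv ℝ fun y ↦ √(g y)) =ᶠ[𝓝 y] fun y ↦ (2 * √(g y))⁻¹ • fderiv ℝ g y := by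
        filter_upwards [hUo.mem_nhds hy] with z hz
        exact hD1eq z hz
      rw [hev.fderiv_eq]
      have hdg : DifferentiableAt ℝ (fderiv ℝ g) y :=
        (((hgC y hy).of_le htwo).fderiv_right (m := 1) le_rfl).differentiableAt one_ne_zero
      rw [fderiv_fun_smul (hφd y hy).differentiableAt hdg, (hφd y hy).fderiv]
    have hle : ∀ᶠ y in cobounded E, ‖iteratedFDeriv ℝ 2 (fun y ↦ √(g y)) y‖ ≤
        ‖(2 * √(g y))⁻¹‖ * ‖fderiv ℝ (fderiv ℝ g) y‖ +
          ‖4⁻¹ * (√(g y))⁻¹ ^ 3‖ * (‖fderiv ℝ g y‖ * ‖fderiv ℝ g y‖) := by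
      filter_upwards [eventually_cobounded_lt_norm (E := E) R] with y hy
      rw [← norm_iteratedFDeriv_fderiv, norm_iteratedFDeriv_one, hF y hy]
      refine (norm_add_le ((2 * √(g y))⁻¹ • fderiv ℝ (fderiv ℝ g) y)
        (((-(4⁻¹ * (√(g y))⁻¹ ^ 3)) • fderiv ℝ g y).smulRight (fderiv ℝ g y))).trans
        (add_le_add ?_ ?_)
      · exact ContinuousLinearMap.opNorm_smul_le _ _
      · exact le_of_eq (by rw [ContinuousLinearMap.norm_smulRight_apply, norm_smul, norm_neg, mul_assoc])
    have hexpA : (fun y : E ↦ ‖y‖ ^ (-(b / 2)) * ‖y‖ ^ (b - 2)) =ᶠ[cobounded E]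
        fun y ↦ ‖y‖ ^ (b / 2 - 2) := by
      rw [show b / 2 - 2 = -(b / 2) + (b - 2) by ring]
      exact norm_rpow_mul_rpow_eventuallyEq (E := E) _ _
    have hexpB : (fun y : E ↦ ‖y‖ ^ (-(3 * (b / 2))) * (‖y‖ ^ (b - 1) * ‖y‖ ^ (b - 1))) =ᶠ[cobounded E]
        fun y ↦ ‖y‖ ^ (b / 2 - 2) := by
      filter_upwards [eventually_cobounded_le_norm (E := E) 1] with y hy
      rw [← Real.rpow_add (by linarith), ← Real.rpow_add (by linarith)]
      congr 1
      ring
    rw [Nat.cast_ofNat]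
    refine (IsBigO.of_norm_eventuallyLE ?_).trans
      (((hφ.norm_left.mul hD2g).trans hexpA.isBigO).add
        (((hψ.const_mul_left 4⁻¹).norm_left.mul (hDg.mul hDg)).trans hexpB.isBigO))
    filter_upwards [hle] with y hy
    exact (norm_norm (iteratedFDeriv ℝ 2 (fun y ↦ √(g y)) y)).trans_le hy

end IsBigOSmooth

end Literature.Geometry.Lorentzian

end
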